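import Literature.Probability.Percolation.StaircaseJunctions
import Literature.Probability.Percolation.StaircaseArcs
import HarnessLib

/-!
# Staircase corridors: the tube chain of one exit over the ring levels

Topic: Probability / Percolation; family `crit-perc`. A brick of the GENERIC landing layer of
Nolin's arm-separation theorem (Nolin 2008, Thm. 11, §4.3 Prop. 12 and §4.4 [arXiv 0711.4948:
Prop. 11, Thm. 10, p. 12, Fig. 6: "RSW in corridors"]), towards
`Literature.Probability.Percolation.Nolin2008_prop17_quasiMult` (`FiveArmExponentFacts.lean`).

The corridor of one exit climbs the ring levels `ℓ₀, ℓ₀ + 1, …, ℓ₀ + m` (radii `r ℓ`, multiples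
of the chunk `s`, increasing): at each level a directed arc of the thin ring (`Staircase.darc`,
`StaircaseArcs.lean`) from the corridor's current piece to its next piece, then — except at the
top — the level connector at that piece (`Staircase.levelConn`, `StaircaseJunctions.lean`) up
to the next ring, where the next arc starts at the piece straight above (`Staircase.upIdx`). The
lateral data are a side `i ℓ` and a piece index `j ℓ` of the START of the arc of the level `ℓ`
and a side `i' ℓ`, piece index `j' ℓ` of its END, with the coherence `i (ℓ+1) = i' ℓ`,
`j (ℓ+1) = upIdx q (i' ℓ) (j' ℓ)` (`r (ℓ+1) = r ℓ + q s`). The chain is a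
`List.IsChain Tube.Crosses` chain (`Staircase.isChain_corridor`), ready for the landing move
`rot_exit_landing_move_chain'` (`TrapExitChainMove.lean`).

## Main definitions

* `Staircase.CorridorData` — radii, sides, piece indices, directions per level;
* `Staircase.corridor D ℓ m` — the tube chain from the level `ℓ` over `m` further levels.

## Main results

* `Staircase.isChain_corridor` — it is a chain of crossing tubes;
* `Staircase.head?_corridor` — it starts at the ring tube of the start piece of the level `ℓ`;
* `Staircase.mem_corridor` — its tubes are ring tubes of the levels `ℓ … ℓ + m` or level
  connectors between consecutive ones.

## References

* P. Nolin, *Near-critical percolation in two dimensions*, Electron. J. Probab. 13 (2008), §4.3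
  Prop. 12 (proof), §4.4 (arXiv 0711.4948: Prop. 11; proof of Thm. 10, p. 12, Fig. 6). [Nolin2008]
* H. Kesten, *Scaling relations for 2D-percolation*, Comm. Math. Phys. 109 (1987), Lemma 4.
  [Kesten1987]
-/

noncomputable section

namespace Literature.Probability.Percolation

open LatticeModels Tube

namespace Staircase

/-- **The data of a staircase corridor**: ring radii `r ℓ`, tube half-width `e`, chunk `s`,
connector half-width `e'`; per level the side and piece index of the start (`i, j`) and of the
end (`i', j'`) of the arc, and its direction `cw`. [cite: Nolin2008, §4.4 (arXiv 0711.4948: proof of Thm. 10, p. 12, Fig. 6)] -/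
structure CorridorData where
  /-- radius of the ring of level `ℓ` -/
  r : ℕ → ℕ
  /-- half-width of the ring tubes -/
  e : ℕ
  /-- chunk length -/
  s : ℕ
  /-- half-width of the level connectors -/
  e' : ℕ
  /-- side of the start piece of the arc of level `ℓ` -/
  i : ℕ → ℕ
  /-- index of the start piece of the arc of level `ℓ` -/
  j : ℕ → ℕ
  /-- side of the end piece of the arc of level `ℓ` -/
  i' : ℕ → ℕ
  /-- index of the end piece of the arc of level `ℓ` -/
  j' : ℕ → ℕ
  /-- direction of the arc of level `ℓ` -/
  cw : ℕ → Bool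

namespace CorridorData

variable (D : CorridorData)

/-- chunks per side at level `ℓ` [folklore] -/
def n (ℓ : ℕ) : ℕ := D.r ℓ / D.s
/-- ring position of the start piece at level `ℓ` [folklore] -/
def g (ℓ : ℕ) : ℕ := extPos (D.n ℓ) (D.i ℓ) (D.j ℓ)
/-- ring position of the end piece at level `ℓ` [folklore] -/
def g' (ℓ : ℕ) : ℕ := extPos (D.n ℓ) (D.i' ℓ) (D.j' ℓ)
/-- the arc of level `ℓ` [folklore] -/
def arcAt (ℓ : ℕ) : List Tube := darc (D.r ℓ) D.e D.s (D.g ℓ) (D.g' ℓ) (D.cw ℓ)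
/-- the connector leaving level `ℓ` [folklore] -/
def connAt (ℓ : ℕ) : Tube := levelConn (D.r ℓ) (D.r (ℓ + 1)) D.e' D.s (D.i' ℓ) (D.j' ℓ)

/-- **Well-formed corridor data on the levels `ℓ < L`**: sizes, sides `< 6`, indices in range,
radii increasing by multiples of `s`, and the coherence of consecutive levels. [folklore] -/
structure WF (L : ℕ) : Prop where
  hs : 1 ≤ D.s
  hee' : D.e ≤ D.e'
  hes : 2 * D.e' ≤ D.s
  hsr : ∀ ℓ < L, D.s ∣ D.r ℓ
  hr : ∀ ℓ < L, 1 ≤ D.r ℓ / D.s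
  hi : ∀ ℓ < L, D.i ℓ < 6
  hi' : ∀ ℓ < L, D.i' ℓ < 6
  hj : ∀ ℓ < L, D.j ℓ < D.r ℓ / D.s
  hj' : ∀ ℓ < L, D.j' ℓ < D.r ℓ / D.s
  hup : ∀ ℓ, ℓ + 1 < L → ∃ q, D.r (ℓ + 1) = D.r ℓ + q * D.s ∧ D.i (ℓ + 1) = D.i' ℓ ∧ D.j (ℓ + 1) = upIdx q (D.i' ℓ) (D.j' ℓ)

end CorridorData

/-- **The staircase corridor** from the level `ℓ` over `m` further levels: arc, connector, arc,
…, arc. [cite: Nolin2008, §4.4 (arXiv 0711.4948: proof of Thm. 10, p. 12, Fig. 6)] -/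
def corridor (D : CorridorData) : ℕ → ℕ → List Tube
  | ℓ, 0 => D.arcAt ℓ
  | ℓ, m + 1 => D.arcAt ℓ ++ D.connAt ℓ :: corridor D (ℓ + 1) m

variable {D : CorridorData}

/-- The ring positions of well-formed data are in range. [folklore] -/
theorem CorridorData.WF.g_lt {L : ℕ} (hW : D.WF L) {ℓ : ℕ} (hℓ : ℓ < L) : D.g ℓ < 12 * (D.r ℓ / D.s) - 4 :=
  extPos_lt (hW.hr ℓ hℓ) (hW.hi ℓ hℓ) (hW.hj ℓ hℓ)

/-- The ring positions of well-formed data are in range. [folklore] -/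
theorem CorridorData.WF.g'_lt {L : ℕ} (hW : D.WF L) {ℓ : ℕ} (hℓ : ℓ < L) : D.g' ℓ < 12 * (D.r ℓ / D.s) - 4 :=
  extPos_lt (hW.hr ℓ hℓ) (hW.hi' ℓ hℓ) (hW.hj' ℓ hℓ)

/-- The corridor starts with the ring tube of the start piece. [folklore] -/
theorem head?_corridor {L : ℕ} (hW : D.WF L) : ∀ (ℓ m : ℕ), ℓ + m < L →
    (corridor D ℓ m).head? = some (ringTube (D.r ℓ) D.e D.s (D.g ℓ))
  | ℓ, 0, h => head?_darc (hW.hr ℓ (by omega)) (hW.g_lt (by omega)) (hW.g'_lt (by omega)) _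
  | ℓ, m + 1, h => by
    show (D.arcAt ℓ ++ D.connAt ℓ :: corridor D (ℓ + 1) m).head? = _
    rw [List.head?_append]
    have h0 : (D.arcAt ℓ).head? = some (ringTube (D.r ℓ) D.e D.s (D.g ℓ)) :=
      head?_darc (hW.hr ℓ (by omega)) (hW.g_lt (by omega)) (hW.g'_lt (by omega)) _
    rw [h0]
    rfl

/-- **The staircase corridor is a chain of crossing tubes.** [cite: Nolin2008, §4.4 (arXiv 0711.4948: proof of Thm. 10, p. 12, Fig. 6)] -/
theorem isChain_corridor {L : ℕ} (hW : D.WF L) : ∀ (ℓ m : ℕ), ℓ + m < L → List.IsChain Crosses (corridor D ℓ m)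
  | ℓ, 0, h => isChain_darc hW.hs (hW.hsr ℓ (by omega)) (Nat.le_of_dvd (by have := hW.hr ℓ (by omega); have := Nat.div_pos_iff.1 (by omega : 0 < D.r ℓ / D.s); omega) (hW.hsr ℓ (by omega))) _ _ _
  | ℓ, m + 1, h => by
    show List.IsChain Crosses (D.arcAt ℓ ++ D.connAt ℓ :: corridor D (ℓ + 1) m)
    have hrℓ := hW.hr ℓ (by omega)
    have hsr := hW.hsr ℓ (by omega)
    have hspos : 0 < D.r ℓ / D.s := hrℓ
    have hsle : D.s ≤ D.r ℓ := Nat.le_of_dvd (by have := Nat.div_pos_iff.1 hspos; omega) hsr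
    obtain ⟨q, hq, hi1, hj1⟩ := hW.hup ℓ (by omega)
    refine isChain_append_conn (isChain_darc hW.hs hsr hsle _ _ _) (isChain_corridor hW (ℓ + 1) m (by omega)) ?_ ?_
    · intro x hx
      have hl : (D.arcAt ℓ).getLast? = some (ringTube (D.r ℓ) D.e D.s (D.g' ℓ)) :=
        getLast?_darc hrℓ (hW.g_lt (by omega)) (hW.g'_lt (by omega)) _
      rw [hl, Option.mem_def, Option.some.injEq] at hx
      subst hx
      exact crosses_ringTube_levelConn hrℓ (hW.hi' ℓ (by omega)) (hW.hj' ℓ (by omega))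
        (by rw [hq]; exact Nat.le_add_right _ _) hW.hee' hW.hes
    · intro y hy
      rw [head?_corridor hW (ℓ + 1) m (by omega), Option.mem_def, Option.some.injEq] at hy
      subst hy
      unfold CorridorData.connAt CorridorData.g
      rw [show D.n (ℓ + 1) = D.r (ℓ + 1) / D.s from rfl, hi1, hj1]
      exact crosses_levelConn_ringTube hW.hs hrℓ (hW.hi' ℓ (by omega)) (hW.hj' ℓ (by omega)) hq hW.hee' hW.hes

/-- **The tubes of the corridor**: ring tubes of the thin rings of the levels `ℓ, …, ℓ + m`, or
the level connectors leaving the levels `ℓ, …, ℓ + m - 1`. [folklore] -/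
theorem mem_corridor : ∀ (ℓ m : ℕ) {T : Tube}, T ∈ corridor D ℓ m →
    (∃ ℓ', ℓ ≤ ℓ' ∧ ℓ' ≤ ℓ + m ∧ T ∈ D.arcAt ℓ') ∨ (∃ ℓ', ℓ ≤ ℓ' ∧ ℓ' < ℓ + m ∧ T = D.connAt ℓ')
  | ℓ, 0, T, h => Or.inl ⟨ℓ, le_rfl, by omega, h⟩
  | ℓ, m + 1, T, h => by
    change T ∈ D.arcAt ℓ ++ D.connAt ℓ :: corridor D (ℓ + 1) m at h
    rw [List.mem_append, List.mem_cons] at h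
    rcases h with h | h | h
    · exact Or.inl ⟨ℓ, le_rfl, by omega, h⟩
    · exact Or.inr ⟨ℓ, le_rfl, by omega, h⟩
    · rcases mem_corridor (ℓ + 1) m h with ⟨ℓ', h1, h2, h3⟩ | ⟨ℓ', h1, h2, h3⟩
      · exact Or.inl ⟨ℓ', by omega, by omega, h3⟩
      · exact Or.inr ⟨ℓ', by omega, by omega, h3⟩

/-- The arcs of the corridor consist of tubes of the thin rings. [folklore] -/
theorem mem_thinRing_of_mem_arcAt {ℓ : ℕ} {T : Tube} (hT : T ∈ D.arcAt ℓ) : T ∈ thinRing (D.r ℓ) D.e D.s :=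
  mem_thinRing_of_mem_darc hT

end Staircase

end Literature.Probability.Percolation
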